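import Literature.AlgebraicGeometry.Resolution.DifferentialOperators
import Mathlib.Algebra.Polynomial.HasseDeriv
import Mathlib.RingTheory.Polynomial.Basic
import Mathlib.RingTheory.Noetherian.Basic
import Mathlib.RingTheory.Finiteness.Basic
import Mathlib.Data.Nat.Choose.Lucas
import Mathlib.Algebra.CharP.Lemmas
import Mathlib.Algebra.CharP.Frobenius
import HarnessLib

/-!
# Differential operators on the affine line: exact order of the Hasse derivatives, `Diff_{K[X]/K}` is not
# finitely generated, every `Diff^{≤ m}_{K[X]/K}` is

Topic: `Literature/AlgebraicGeometry/Resolution` (companion of `DifferentialOperators.lean` — Grothendieck's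
`IsDiffOpLE` / `diffOp`, EGA IV₄ 16.8.8 (b) — and of `HasseSchmidtDerivatives.lean`, which treats the
MULTIVARIATE Hasse–Schmidt derivatives of `MvPolynomial σ R` and proves `D^{(α)} ∈ Diff^{≤ |α|}`). This file is the
ONE-VARIABLE layer over Mathlib's `Polynomial.hasseDeriv k : K[X] →ₗ[K] K[X]`, with the facts EGA IV₄ Thm. 16.11.2
yields for `𝔸¹_K → Spec K` («les `D_q` tels que `|q| ≤ m` forment une base du `𝒪_U`-Module `Diff^m`»), proved here
directly from the commutator definition:

* `commMul_polyHasseDeriv_succ_X`: `[D^{(k+1)}, X] = D^{(k)}`; `commMul_polyHasseDeriv`: `[D^{(k)}, a] =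
  Σ_{i+j=k, i≥1} (D^{(i)} a)·D^{(j)}`; hence `isDiffOpLE_polyHasseDeriv`: `D^{(k)} ∈ Diff^{≤ n}` for `k ≤ n`, and over a
  NONTRIVIAL `K`, `not_isDiffOpLE_polyHasseDeriv`: `D^{(k)} ∉ Diff^{≤ n}` for `n < k` — `polyHasseDeriv_mem_diffOp_iff`:
  **`D^{(k)}` has order exactly `k`**; `diffOp_polynomial_lt_succ`: the order filtration is strictly increasing.
* For ANY `K`-algebra `A`: a finitely generated `A`-submodule of `Diff_{A/K} = ⨆_m Diff^{≤ m}` has bounded order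
  (`exists_le_diffOp_of_fg`), so a submodule with members of unbounded order is not finitely generated
  (`not_fg_of_unbounded_order`); in particular **`Diff_{K[X]/K}` is not a finitely generated `K[X]`-module**
  (`not_fg_iSup_diffOp_polynomial`, `K` nontrivial, every characteristic).
* `eq_zero_of_isDiffOpLE_of_apply_X_pow_eq_zero`: an operator of order `≤ m` vanishing on `1, X, …, X^m` is zero; so
  evaluation at these powers embeds `Diff^{≤ m}` `K[X]`-linearly into `K[X]^{m+1}` and, for `K`
  Noetherian, **every `K[X]`-submodule of `Diff^{≤ m}_{K[X]/K}` is finitely generated** (`fg_of_le_diffOp_polynomial`,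
  `diffOp_polynomial_fg`).
* Characteristic `p`: `polyHasseDeriv_pow_char_pow`: **`D^{(k)}(g^{p^e}) = 0` whenever `p^e ∤ k`** (Lucas:
  `p ∣ C(p^e a, k)`, a private helper from Mathlib's `Choose.lucas_theorem` digits) — the operators of order NOT divisible by `q = p^e` annihilate
  the subring of `q`-th powers.

What is NOT here: the basis theorem itself (`Diff^{≤ m}_{K[X]/K}` free on `D^{(0)}, …, D^{(m)}`), the multivariate
exact-order statement (see `HasseSchmidtDerivatives.hasseSchmidtDiff_eq_diffOp`, a named fact), and anything about
smooth algebras other than polynomial rings.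

Sources: [EGAIV4] A. Grothendieck, J. Dieudonné, ÉGA IV₄, Publ. Math. IHÉS 32 (1967), Déf. 16.8.1, Prop. 16.8.8,
Thm. 16.11.2. Lucas's theorem on binomial coefficients mod `p` is Mathlib's `Choose.lucas_theorem` (the corollaries
below are tagged folklore).
-/

noncomputable section

open Polynomial

namespace Literature.AlgebraicGeometry.Resolution

/-! ## Finite generation inside `Diff_{A/K}` forces bounded order (any `K`-algebra `A`) -/

section General

variable {K : Type*} {A : Type*} [CommRing K] [CommRing A] [Algebra K A]

/-- **A finitely generated submodule of `Diff_{A/K} = ⋃_m Diff^{≤ m}_{A/K}` has bounded order**: it lies in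
`Diff^{≤ M}` for some `M` (each of finitely many generators lies in one member of the increasing union).
[cite: EGAIV4, Déf. 16.8.1 (16.8.1.1: the increasing filtration (Diff^n) and Diff = ⋃ Diff^n)] -/
theorem exists_le_diffOp_of_fg {P : Submodule A (A →ₗ[K] A)} (hP : P.FG)
    (hle : P ≤ ⨆ m : ℕ, diffOp K A m) : ∃ M : ℕ, P ≤ diffOp K A M := by
  obtain ⟨S, hS⟩ := hP
  have hdir : Directed (· ≤ ·) (fun m : ℕ => diffOp K A m) :=
    Monotone.directed_le fun m n hmn => diffOp_mono hmn
  have hmem : ∀ s ∈ S, ∃ m, (s : A →ₗ[K] A) ∈ diffOp K A m := fun s hs =>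
    (Submodule.mem_iSup_of_directed _ hdir).1 (hle (hS ▸ Submodule.subset_span hs))
  choose! m hm using hmem
  refine ⟨S.sup m, ?_⟩
  rw [← hS, Submodule.span_le]
  intro s hs
  exact diffOp_mono (Finset.le_sup hs) (hm s hs)

/-- If `Diff_{A/K}` (the `A`-submodule `⨆ m, diffOp K A m` of `A →ₗ[K] A`) is finitely generated, the order
filtration stabilises: `Diff_{A/K} = Diff^{≤ M}` for some `M`. [cite: EGAIV4, Déf. 16.8.1] -/
theorem exists_iSup_diffOp_eq_of_fg (h : (⨆ m : ℕ, diffOp K A m).FG) :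
    ∃ M : ℕ, (⨆ m : ℕ, diffOp K A m) = diffOp K A M := by
  obtain ⟨M, hM⟩ := exists_le_diffOp_of_fg h le_rfl
  exact ⟨M, le_antisymm hM (le_iSup (fun m => diffOp K A m) _)⟩

/-- **Unbounded order ⇒ not finitely generated**: a submodule of `Diff_{A/K}` containing, for every `M`, an operator
that is not of order `≤ M` is not a finitely generated `A`-module. [cite: EGAIV4, Déf. 16.8.1] -/
theorem not_fg_of_unbounded_order {P : Submodule A (A →ₗ[K] A)} (hle : P ≤ ⨆ m : ℕ, diffOp K A m)
    (h : ∀ M : ℕ, ∃ D ∈ P, ¬ IsDiffOpLE K M D) : ¬ P.FG := fun hP => by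
  obtain ⟨M, hM⟩ := exists_le_diffOp_of_fg hP hle
  obtain ⟨D, hD, hD'⟩ := h M
  exact hD' (hM hD)

end General

/-! ## The affine line: Mathlib's `Polynomial.hasseDeriv` against `IsDiffOpLE` -/

section AffineLine

variable {K : Type*} [CommRing K]

/-- **`[D^{(k+1)}, X] = D^{(k)}`** on `K[X]` (higher Leibniz rule with `D^{(1)} X = 1`, `D^{(j)} X = 0` for `j ≥ 2`).
[cite: EGAIV4, Thm. 16.11.2 ((16.11.2.2), Leibniz formula for the D_q)] -/
theorem commMul_polyHasseDeriv_succ_X (k : ℕ) :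
    commMul K (hasseDeriv (k + 1) : K[X] →ₗ[K] K[X]) X = hasseDeriv k := by
  refine LinearMap.ext fun f => ?_
  rw [commMul_apply, hasseDeriv_mul, Finset.Nat.sum_antidiagonal_succ, Finset.sum_eq_single (0, k)]
  · simp only [zero_add, hasseDeriv_zero', hasseDeriv_one', derivative_X, one_mul]
    ring
  · intro ij hij hne
    have h1 : ij.1 ≠ 0 := by
      intro h
      apply hne
      rw [Finset.mem_antidiagonal] at hij
      exact Prod.ext h (by simpa [h] using hij)
    have h2 : 1 < ij.1 + 1 := by omega
    rw [hasseDeriv_X _ h2, zero_mul]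
  · intro h
    exact absurd (by simp) h

/-- **`[D^{(k)}, a] = Σ_{i+j=k, i≥1} (D^{(i)} a) · D^{(j)}`** on `K[X]` (Leibniz rule minus its `i = 0` term): an
`K[X]`-combination of Hasse derivatives of strictly smaller order. [cite: EGAIV4, Prop. 16.8.8 (b) with Thm. 16.11.2] -/
theorem commMul_polyHasseDeriv (k : ℕ) (a : K[X]) :
    commMul K (hasseDeriv k : K[X] →ₗ[K] K[X]) a =
      ∑ ij ∈ (Finset.antidiagonal k).erase (0, k),
        hasseDeriv ij.1 a • (hasseDeriv ij.2 : K[X] →ₗ[K] K[X]) := by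
  refine LinearMap.ext fun t => ?_
  have h0 : ((0 : ℕ), k) ∈ Finset.antidiagonal k := by simp
  rw [commMul_apply, hasseDeriv_mul, ← Finset.add_sum_erase _ _ h0, LinearMap.sum_apply]
  simp only [hasseDeriv_zero', LinearMap.smul_apply, smul_eq_mul]
  ring

/-- **`D^{(k)} ∈ Diff^{≤ n}_{K[X]/K}` for `k ≤ n`** (induction on `n` through `commMul_polyHasseDeriv`).
[cite: EGAIV4, Thm. 16.11.2 (|q| ≤ m ⇒ D_q ∈ Diff^m)] -/
theorem isDiffOpLE_polyHasseDeriv :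
    ∀ (n k : ℕ), k ≤ n → IsDiffOpLE K n (hasseDeriv k : K[X] →ₗ[K] K[X])
  | 0, k, hk => by
    obtain rfl : k = 0 := Nat.le_zero.1 hk
    rw [hasseDeriv_zero]
    exact isDiffOpLE_id
  | n + 1, k, hk => fun a => by
    rw [commMul_polyHasseDeriv]
    refine IsDiffOpLE.sum _ fun ij hij => IsDiffOpLE.smul _ (isDiffOpLE_polyHasseDeriv n ij.2 ?_)
    obtain ⟨hne, hij⟩ := Finset.mem_erase.1 hij
    rw [Finset.mem_antidiagonal] at hij
    have : ij.1 ≠ 0 := fun h => hne (Prod.ext h (by simpa [h] using hij))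
    omega

/-- `D^{(k)} ∈ diffOp K K[X] n` for `k ≤ n` (submodule form). [cite: EGAIV4, Thm. 16.11.2] -/
theorem polyHasseDeriv_mem_diffOp {n k : ℕ} (h : k ≤ n) :
    (hasseDeriv k : K[X] →ₗ[K] K[X]) ∈ diffOp K K[X] n :=
  isDiffOpLE_polyHasseDeriv n k h

/-- `D^{(k)} (X^k) = 1`. [cite: EGAIV4, Thm. 16.11.2 ((16.11.2.1): D_q(z^n) = (n choose q) z^{n−q})] -/
theorem polyHasseDeriv_X_pow_self (k : ℕ) : hasseDeriv k ((X : K[X]) ^ k) = 1 := by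
  rw [X_pow_eq_monomial, hasseDeriv_monomial, Nat.choose_self, Nat.sub_self, Nat.cast_one, one_mul]
  rfl

/-- **`D^{(k)}` is NOT of order `≤ n` for `n < k`** over a nontrivial `K`: iterating `[·, X]` `n + 1` times sends
`D^{(k)}` to `D^{(k−n−1)} ≠ 0` (it maps `X^{k−n−1}` to `1`).
[cite: EGAIV4, Thm. 16.11.2 (the D_q with |q| ≤ m form a basis of Diff^m, so D_q ∉ Diff^m for |q| > m)] -/
theorem not_isDiffOpLE_polyHasseDeriv [Nontrivial K] :
    ∀ (n k : ℕ), n < k → ¬ IsDiffOpLE K n (hasseDeriv k : K[X] →ₗ[K] K[X])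
  | 0, k, hk, h => by
    obtain ⟨k, rfl⟩ : ∃ j, k = j + 1 := ⟨k - 1, by omega⟩
    have h1 := h X
    rw [commMul_polyHasseDeriv_succ_X] at h1
    have h2 := congrArg (fun D : K[X] →ₗ[K] K[X] => D (X ^ k)) h1
    simp only [polyHasseDeriv_X_pow_self, LinearMap.zero_apply] at h2
    exact one_ne_zero h2
  | n + 1, k, hk, h => by
    obtain ⟨k, rfl⟩ : ∃ j, k = j + 1 := ⟨k - 1, by omega⟩
    have h1 := h X
    rw [commMul_polyHasseDeriv_succ_X] at h1
    exact not_isDiffOpLE_polyHasseDeriv n k (by omega) h1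

/-- **Exact order of the Hasse derivative**: `D^{(k)} ∈ Diff^{≤ n}_{K[X]/K} ↔ k ≤ n` (`K` nontrivial).
[cite: EGAIV4, Thm. 16.11.2] -/
theorem polyHasseDeriv_mem_diffOp_iff [Nontrivial K] {n k : ℕ} :
    (hasseDeriv k : K[X] →ₗ[K] K[X]) ∈ diffOp K K[X] n ↔ k ≤ n :=
  ⟨fun h => not_lt.1 fun hlt => not_isDiffOpLE_polyHasseDeriv n k hlt h,
    fun h => isDiffOpLE_polyHasseDeriv n k h⟩

/-- The order filtration of `Diff_{K[X]/K}` is STRICTLY increasing: `Diff^{≤ n} < Diff^{≤ n+1}` (witness `D^{(n+1)}`;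
`K` nontrivial). [cite: EGAIV4, Thm. 16.11.2] -/
theorem diffOp_polynomial_lt_succ [Nontrivial K] (n : ℕ) : diffOp K K[X] n < diffOp K K[X] (n + 1) :=
  lt_of_le_of_ne (diffOp_mono (Nat.le_succ n)) fun h =>
    not_isDiffOpLE_polyHasseDeriv n (n + 1) (Nat.lt_succ_self n)
      (show (hasseDeriv (n + 1) : K[X] →ₗ[K] K[X]) ∈ diffOp K K[X] n from
        h ▸ isDiffOpLE_polyHasseDeriv (n + 1) (n + 1) le_rfl)

/-- **`Diff_{K[X]/K} = ⋃_m Diff^{≤ m}` is not a finitely generated `K[X]`-module** (`K` nontrivial, every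
characteristic): it contains the `D^{(k)}` of all orders. [cite: EGAIV4, Thm. 16.11.2] -/
theorem not_fg_iSup_diffOp_polynomial [Nontrivial K] : ¬ (⨆ m : ℕ, diffOp K K[X] m).FG :=
  not_fg_of_unbounded_order le_rfl fun M =>
    ⟨hasseDeriv (M + 1), Submodule.mem_iSup_of_mem (M + 1) (polyHasseDeriv_mem_diffOp le_rfl),
      not_isDiffOpLE_polyHasseDeriv M (M + 1) (Nat.lt_succ_self M)⟩

/-! ### `Diff^{≤ m}_{K[X]/K}` is determined on `1, X, …, X^m`; finite generation -/

/-- **An operator of order `≤ m` on `K[X]` that kills `1, X, …, X^m` is zero** (induction on `m` via `[E, X]`; then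
`E (X t) = X · E t`, so `E (X^j) = 0` for all `j`, and `K`-linearity).
[cite: EGAIV4, Thm. 16.11.2 (an operator of order ≤ m on 𝔸¹ is the combination Σ_{q ≤ m} a_q D_q, determined by its values on z^0, …, z^m)] -/
theorem eq_zero_of_isDiffOpLE_of_apply_X_pow_eq_zero :
    ∀ (m : ℕ) {E : K[X] →ₗ[K] K[X]}, IsDiffOpLE K m E → (∀ j ≤ m, E (X ^ j) = 0) → E = 0
  | 0, E, hE, h0 => by
    rw [isDiffOpLE_zero_iff_eq_mulLeft.1 hE]
    have h1 : E 1 = 0 := by simpa using h0 0 le_rfl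
    rw [h1]
    exact LinearMap.mulLeft_zero_eq_zero _ _
  | m + 1, E, hE, h0 => by
    have hF : commMul K E X = 0 :=
      eq_zero_of_isDiffOpLE_of_apply_X_pow_eq_zero m (hE X) fun j hj => by
        rw [commMul_apply, ← pow_succ', h0 (j + 1) (by omega), h0 j (by omega), mul_zero, sub_zero]
    have hX : ∀ t, E (X * t) = X * E t := fun t => by
      have := congrArg (fun D : K[X] →ₗ[K] K[X] => D t) hF
      simpa [commMul_apply, sub_eq_zero] using this
    have h1 : E 1 = 0 := by simpa using h0 0 (Nat.zero_le _)
    have hpow : ∀ j : ℕ, E (X ^ j) = 0 := by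
      intro j
      induction j with
      | zero => simpa using h1
      | succ j ih => rw [pow_succ', hX, ih, mul_zero]
    refine Polynomial.lhom_ext' fun n => LinearMap.ext_ring ?_
    simp only [LinearMap.comp_apply, LinearMap.zero_comp, LinearMap.zero_apply]
    rw [← C_mul_X_pow_eq_monomial, map_one, one_mul]
    exact hpow n

/-- **Every `K[X]`-submodule of `Diff^{≤ m}_{K[X]/K}` is finitely generated** when `K` is Noetherian (it embeds into
the Noetherian module `K[X]^{m+1}` by evaluation at `1, X, …, X^m`). [cite: EGAIV4, Thm. 16.11.2 (Diff^m of 𝔸¹ is free of rank m+1)] -/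
theorem fg_of_le_diffOp_polynomial [IsNoetherianRing K] {P : Submodule K[X] (K[X] →ₗ[K] K[X])} {m : ℕ}
    (hP : P ≤ diffOp K K[X] m) : P.FG := by
  -- evaluation at `1, X, …, X^m`, a `K[X]`-linear map into the Noetherian module `K[X]^{m+1}`
  let ev : (K[X] →ₗ[K] K[X]) →ₗ[K[X]] (Fin (m + 1) → K[X]) :=
    LinearMap.pi fun j => LinearMap.applyₗ' K[X] ((X : K[X]) ^ (j : ℕ))
  have hinj : Function.Injective (ev.domRestrict P) := by
    intro x y hxy
    apply Subtype.ext
    rw [← sub_eq_zero]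
    refine eq_zero_of_isDiffOpLE_of_apply_X_pow_eq_zero m (IsDiffOpLE.sub (hP x.2) (hP y.2)) fun j hj => ?_
    have := congrFun hxy ⟨j, Nat.lt_succ_of_le hj⟩
    simp only [LinearMap.domRestrict_apply, ev, LinearMap.pi_apply, LinearMap.applyₗ'_apply_apply] at this
    rw [LinearMap.sub_apply, this, sub_self]
  have : Module.Finite K[X] P := Module.Finite.of_injective _ hinj
  exact Module.Finite.iff_fg.1 this

/-- In particular **`Diff^{≤ m}_{K[X]/K}` is a finitely generated `K[X]`-module** (`K` Noetherian).
[cite: EGAIV4, Thm. 16.11.2] -/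
theorem diffOp_polynomial_fg [IsNoetherianRing K] (m : ℕ) : (diffOp K K[X] m).FG :=
  fg_of_le_diffOp_polynomial le_rfl

/-! ### Characteristic `p`: `D^{(k)}` annihilates `p^e`-th powers unless `p^e ∣ k` -/

/-- One digit of Lucas's theorem: `p ∣ C(p·a, k)` when `p ∤ k` (from Mathlib's
`Choose.choose_modEq_choose_mod_mul_choose_div_nat`; private helper). [folklore] -/
private theorem dvd_choose_mul_of_not_dvd {p : ℕ} [Fact p.Prime] (a : ℕ) {k : ℕ} (hk : ¬ p ∣ k) :
    p ∣ (p * a).choose k := by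
  have h := Choose.choose_modEq_choose_mod_mul_choose_div_nat (n := p * a) (k := k) (p := p)
  have hk' : 0 < k % p := Nat.pos_of_ne_zero fun h0 => hk (Nat.dvd_of_mod_eq_zero h0)
  rw [Nat.mul_mod_right, Nat.choose_eq_zero_of_lt hk', zero_mul] at h
  exact (Nat.modEq_zero_iff_dvd).1 h

/-- Lucas's theorem, iterated: `p ∣ C(p^e·a, k)` when `p^e ∤ k` (private helper). [folklore] -/
private theorem dvd_choose_pow_mul_of_not_dvd {p : ℕ} [Fact p.Prime] :
    ∀ (e a : ℕ) {k : ℕ}, ¬ p ^ e ∣ k → p ∣ (p ^ e * a).choose k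
  | 0, _, k, h => absurd (one_dvd k) (by simpa only [pow_zero] using h)
  | e + 1, a, k, h => by
    by_cases hpk : p ∣ k
    · obtain ⟨k', rfl⟩ := hpk
      have h' : ¬ p ^ e ∣ k' := fun hd => h (by rw [pow_succ']; exact mul_dvd_mul_left p hd)
      have ih := dvd_choose_pow_mul_of_not_dvd e a h'
      have hmod := Choose.choose_mul_mul_modEq_choose_nat (p := p) (a := p ^ e * a) (b := k')
      rw [pow_succ', mul_assoc]
      exact (Nat.modEq_zero_iff_dvd).1 (hmod.trans ((Nat.modEq_zero_iff_dvd).2 ih))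
    · rw [pow_succ', mul_assoc]
      exact dvd_choose_mul_of_not_dvd _ hpk

/-- In characteristic `p`, **`D^{(k)}(g^{p^e}) = 0` for every `g ∈ K[X]` whenever `p^e ∤ k`**:
`D^{(k)}((Σ a_i X^i)^{p^e}) = Σ a_i^{p^e} C(i p^e, k) X^{i p^e − k}` and `p ∣ C(i p^e, k)`. So the Hasse derivatives of
order not divisible by `q = p^e` annihilate the subring `K[X]^q` of `q`-th powers.
[cite: EGAIV4, Thm. 16.11.2 ((16.11.2.1): D_q(z^n) = (n choose q) z^{n−q})] -/
theorem polyHasseDeriv_pow_char_pow (p : ℕ) [Fact p.Prime] [CharP K p] (e : ℕ) {k : ℕ} (hk : ¬ p ^ e ∣ k)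
    (g : K[X]) : hasseDeriv k (g ^ p ^ e) = 0 := by
  induction g using Polynomial.induction_on' with
  | add f g hf hg => rw [add_pow_char_pow, map_add, hf, hg, add_zero]
  | monomial n a =>
    rw [monomial_pow, hasseDeriv_monomial, mul_comm n,
      (CharP.cast_eq_zero_iff K p _).2 (dvd_choose_pow_mul_of_not_dvd e n hk), zero_mul,
      monomial_zero_right]

/-- The same through Mathlib's `iterateFrobenius`: `D^{(k)}` vanishes on the range of `ρ^e = Frob^e` when `p^e ∤ k`.
[cite: EGAIV4, Thm. 16.11.2 ((16.11.2.1))] -/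
theorem polyHasseDeriv_iterateFrobenius (p : ℕ) [Fact p.Prime] [CharP K p] (e : ℕ) {k : ℕ} (hk : ¬ p ^ e ∣ k)
    (g : K[X]) : hasseDeriv k (iterateFrobenius K[X] p e g) = 0 := by
  rw [iterateFrobenius_def]
  exact polyHasseDeriv_pow_char_pow p e hk g

end AffineLine

end Literature.AlgebraicGeometry.Resolution

end
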